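import Mathlib
import Summits.Ventures.PercRepro2.TwoSepGlue

/-!
# Gluing at a 2-separator, Ia: the exact realisability of a far pattern (blind cell PercRepro2,
mine-2 g46, 2026-08-29; `conjectures/MINE-2.md` M2-95)

`TwoSepGlue.FPok` only records that the far identification `c ↔ d` forces `c ↔ m` and `d ↔ m` to
agree; it admits the sixth pattern `(c ↔ d false, c ↔ m true, d ↔ m true)`, which no configuration
realises (`c ↔ m ↔ d` gives `c ↔ d`).  `FPreal` is the exact condition — the five set partitions of
`{c, d, m}` — with `fp_real` (every far pattern of a configuration is real), `FPreal.ok`, and the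
vanishing of the far-pattern count on every triple with an unreal component
(`farCount_eq_zero_of_not_real`).  The rules of the sequel quantify their orbit hypothesis over the
real triples only (`125` of the `512`).  Own work; standard axioms.
-/

namespace Summit.Ventures.PercRepro2

open UnionCluster

namespace CovForm

namespace RootBridge

open OneTyped TypedA3 Untouched TypedFactor Separated

section Real

open Classical

variable {V : Type*} {E : Type*} (ends : E → Sym2 V)

/-- A far pattern is REAL when it is one of the five set partitions of `{c, d, m}`: `c ↔ d` forces
`c ↔ m` and `d ↔ m` to agree, and `c ↔ m`, `d ↔ m` together force `c ↔ d`. -/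
def FPreal (p : FP) : Prop :=
  (p.1 = true → p.2.1 = p.2.2) ∧ (p.2.1 = true → p.2.2 = true → p.1 = true)

/-- A real pattern is realisable in the weak sense of `FPok`. -/
lemma FPreal.ok {p : FP} (h : FPreal p) : FPok p := h.1

/-- Every far pattern of a configuration is real. -/
lemma fp_real (c d u : V) (y : Config E) : FPreal (fp ends c d u y) := by
  refine ⟨fp_ok ends c d u y, ?_⟩
  intro h1 h2
  simp only [fp, decide_eq_true_eq] at h1 h2 ⊢
  exact conn_trans h1 (conn_symm h2)

/-- An unreal pattern never matches a real one. -/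
lemma exact2_of_not_real {p q : FP} (hp : ¬ FPreal p) (hq : FPreal q) : exact2 p q = 0 := by
  unfold exact2
  rw [if_neg]
  rintro rfl
  exact hp hq

end Real

section RealCounts

open Classical

variable {V : Type*} {E : Type*} [Fintype E] [DecidableEq E] {R : Type*} [Field R]
variable (ends : E → Sym2 V) (c d u : V) (VL : Set V)

/-- The far-pattern count of a triple with an unreal component vanishes. -/
lemma farCount_eq_zero_of_not_real (A : Finset E) (z : Config E) (τ : E → ℕ) (p : Pat3)
    (hp : ¬ FPreal p.1 ∨ ¬ FPreal p.2.1 ∨ ¬ FPreal p.2.2) :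
    typedCount A z τ (farK ends c d u VL p : Config E → Config E → Config E → R) = 0 := by
  rw [← typedCount_zero_kernel A z τ]
  refine typedCount_congr' _ _ _ _ _ fun x y w => ?_
  unfold farK
  rcases hp with hp | hp | hp
  · rw [exact2_of_not_real hp (fp_real ends c d u _)]
    simp
  · rw [exact2_of_not_real hp (fp_real ends c d u _)]
    simp
  · rw [exact2_of_not_real hp (fp_real ends c d u _)]
    simp

end RealCounts

end RootBridge

end CovForm

end Summit.Ventures.PercRepro2
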